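import Mathlib
import Literature.Computability.AlgebraicComplexity.Hyperdeterminant
import Literature.Computability.AlgebraicComplexity.BorderDcQuadraticBoundProofs
import Summits.ValiantsHypothesis.ValiantsHypothesis.Theorems.DetQPDetqpThesisHessianFloor

/-!
# `DetqpThesis` (stmt-ValiantsHypothesis-0315), line `four-dimensional-determinant` — stub C₁:
# the border floor `\underline{dc}(H_n) ≥ n⁴/2` for the four-dimensional determinant

Crux `Summit.ValiantsHypothesis.ValiantsHypothesis.Theses.DetQP.DetqpThesis`, line
`four-dimensional-determinant`, registered stub `stub_borderFloor` (C₁ = stub C on the polynomial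
part `m < n⁴/2` of the window).  Write `H_n := hyperdet (X_I)_{I : Fin 4 → Fin n}` for Cayley's
first hyperdeterminant of the generic `n×n×n×n` array and, for an injective placement `ι` of the
array variables among the `m²` matrix variables missing the padding variable `(0,0)`,
`pp := X₀₀^{m-n} · H_n(X_ι)`.  We prove: for `3 ≤ n ≤ m` and `2m < n⁴`, `pp ∉ Δ(det_m)`.

## Proof

The Landsberg–Manivel–Ressayre invariant of the tree
(`Literature/Computability/AlgebraicComplexity/BorderDcQuadraticBoundProofs.lean`): a polynomial
in the coefficients of a degree-`m` form which vanishes on `GL · det_m`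
(`lmrInvariant_eq_zero_of_mem_glOrbit_detPoly`: at every zero of such a form the Hessian has
rank `≤ 2m`), hence on `Δ(det_m)` (`lmrInvariant_eq_zero_of_mem_orbitClosure`), and which equals
`1` as soon as the univariate family attached to a line and a generalised `(2m+1)`-minor of the
Hessian is linearly independent (`exists_lmrInvariant_eq_one`).  For `pp` we take
(`exists_lmrInvariant_eq_one_paddedHyperdet`, the analogue of the tree's
`exists_lmrInvariant_eq_one_paddedPerPoly`): the point `x₀` = block-diagonal embedding
`K ↦ [K 2 = K 0][K 3 = K 1] y₀(K 0, K 1)` of the Mignon–Ressayre point `y₀` on the used variables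
and `1` elsewhere, and the direction of the used variable `X_{ι(0,0,0,0)}`.  There `H_n` vanishes
and along the line `pp = n!·(n-1)!·t` (`hyperdet_blockArr`: `H_n` of a block-diagonal array is
`n! · per`; `eval_onesExcept_perPoly`), while the Hessian block is `(n!·(n-3)!) •` the invertible
hyperdeterminantal pattern matrix (`hess0_hyperdet_blockEmb_mrPoint`,
`stub_hdPattern_mulVec_injective`, landed by the previous lead of this line), of full rank `n⁴`;
selecting `2m + 1 ≤ n⁴` of its coordinates gives the minor.  This is the BORDER upgrade of the
landed affine floor `n⁴ ≤ 2 · dc(H_n)` (`pow_four_le_two_mul_determinantalComplexity_hyperdet`).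

References: Landsberg–Manivel–Ressayre 2013 (Comment. Math. Helv. 88), Thm 1.2.1 / Lemma 2.4.1;
Mignon–Ressayre 2004.
-/

noncomputable section

-- single-conjunct layout: Sub = Summit, duplicated namespace component intended
set_option linter.dupNamespace false

namespace Summit.ValiantsHypothesis.ValiantsHypothesis.Theorems.DetQPDetqpThesis

open Literature.Computability.AlgebraicComplexity MvPolynomial
open scoped BigOperators Matrix

/-- The four-dimensional determinant of a block-diagonal array `K ↦ [K 2 = K 0][K 3 = K 1] M(K 0, K 1)`
evaluates to `n! · per(M)` (Gurvits 2004, Ex. 3.3; tree `hyperdet_blockArr`). [folklore] -/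
theorem bfl_eval_blockArr_hyperdet {n : ℕ} (M : Fin n × Fin n → ℂ) :
    eval (fun K : Fin 4 → Fin n => if K 2 = K 0 ∧ K 3 = K 1 then M (K 0, K 1) else 0)
      (hyperdet fun I : Fin 4 → Fin n => (X I : MvPolynomial (Fin 4 → Fin n) ℂ)) =
      (n.factorial : ℂ) * eval M (perPoly (Fin n) ℂ) := by
  rw [map_hyperdet]
  simp only [eval_X]
  have hM : (fun K : Fin 4 → Fin n => if K 2 = K 0 ∧ K 3 = K 1 then M (K 0, K 1) else 0)
      = fun K : Fin 4 → Fin n => if K 2 = K 0 ∧ K 3 = K 1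
          then (Matrix.of fun a b : Fin n => M (a, b)) (K 0) (K 1) else 0 := by
    simp only [Matrix.of_apply]
  rw [hM, hyperdet_blockArr, eval_perPoly]

/-- **Hyperdeterminant side of the LMR argument.**  For `n + 3 ≤ m`, `2m + 1 ≤ (n+3)⁴` and an
injective placement `ι` missing `(0,0)`, at the block-embedded Mignon–Ressayre point (extended by
`1` off the used variables) and in the direction of the used variable `X_{ι(0,0,0,0)}`, the padded
four-dimensional determinant restricted to the line is `(n+3)!·(n+2)!·t`, with a root at `t = 0`,
while a suitable generalised `(2m+1)`-minor of its Hessian equals `1` at the point (the used block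
of the Hessian is `((n+3)!·n!) •` the invertible hyperdeterminantal pattern matrix); so the
univariate family is linearly independent and some test matrix gives invariant `1`.
[cite: LandsbergManivelRessayre2013, Lemma 2.4.1] -/
theorem exists_lmrInvariant_eq_one_paddedHyperdet {n m : ℕ} [NeZero m]
    (ι : (Fin 4 → Fin (n + 3)) → Fin m × Fin m) (hι : Function.Injective ι)
    (hℓ : ((0 : Fin m), (0 : Fin m)) ∉ Set.range ι) (hnm : n + 3 ≤ m)
    (hr : 2 * m + 1 ≤ (n + 3) ^ 4) :
    ∃ (x w : Fin m × Fin m → ℂ) (U V : Matrix (Fin (2 * m + 1)) (Fin m × Fin m) ℂ)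
      (L : Matrix (Option (Fin (m * ((2 * m + 1) * m) + 1)))
        (Fin (m * ((2 * m + 1) * m) + m + 1)) ℂ),
      lmrInvariant m (m * ((2 * m + 1) * m)) (m * ((2 * m + 1) * m) + m) x w U V L
        (X ((0 : Fin m), (0 : Fin m)) ^ (m - (n + 3)) *
          rename ι (hyperdet fun I : Fin 4 → Fin (n + 3) =>
            (X I : MvPolynomial (Fin 4 → Fin (n + 3)) ℂ))) = 1 := by
  classical
  set HD : MvPolynomial (Fin 4 → Fin (n + 3)) ℂ :=
    hyperdet fun I : Fin 4 → Fin (n + 3) => (X I : MvPolynomial (Fin 4 → Fin (n + 3)) ℂ) with hHD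
  set g := X ((0 : Fin m), (0 : Fin m)) ^ (m - (n + 3)) * rename ι HD with hg
  -- `HD` is a form of degree `n + 3` (inlined; the same statement is landed as
  -- `HdCalibration.hdc_hyperdet_X_isHomogeneous`), so `g` is a form of degree `m`
  have hHDhom : HD.IsHomogeneous (n + 3) := by
    rw [hHD]
    unfold hyperdet
    apply IsHomogeneous.sum
    intro σ _
    have hsign : (∏ j, ((Equiv.Perm.sign (σ j) : ℤ) : MvPolynomial (Fin 4 → Fin (n + 3)) ℂ)).IsHomogeneous 0 := by
      rw [← Int.cast_prod, ← map_intCast (C : ℂ →+* MvPolynomial (Fin 4 → Fin (n + 3)) ℂ)]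
      exact isHomogeneous_C _ _
    have hprod : (∏ i : Fin (n + 3), (X (fun j => σ j i) : MvPolynomial (Fin 4 → Fin (n + 3)) ℂ)).IsHomogeneous
        (n + 3) := by
      have := IsHomogeneous.prod (Finset.univ : Finset (Fin (n + 3)))
        (fun i => (X (fun j => σ j i) : MvPolynomial (Fin 4 → Fin (n + 3)) ℂ)) (fun _ => 1)
        (fun i _ => isHomogeneous_X ℂ _)
      simpa using this
    simpa using hsign.mul hprod
  have hhom : g.IsHomogeneous m := by
    have h1 : (X ((0 : Fin m), (0 : Fin m)) ^ (m - (n + 3)) : MvPolynomial (Fin m × Fin m) ℂ).IsHomogeneous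
        (1 * (m - (n + 3))) := (isHomogeneous_X ℂ _).pow _
    have h2 : (rename ι HD).IsHomogeneous (n + 3) := hHDhom.rename_isHomogeneous
    have h3 := h1.mul h2
    rwa [one_mul, Nat.sub_add_cancel hnm] at h3
  -- the padding variable is not a used variable
  have hι0 : ∀ u, ι u ≠ (0, 0) := fun u h => hℓ ⟨u, h⟩
  have hpad : ∀ v, pderiv (ι v) (X (0, 0) ^ (m - (n + 3)) : MvPolynomial (Fin m × Fin m) ℂ) = 0 := by
    intro v
    rw [pderiv_pow, pderiv_X_of_ne (hι0 v).symm, mul_zero]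
  -- the point and the direction
  set x₀' : (Fin 4 → Fin (n + 3)) → ℂ := fun K =>
    if K 2 = K 0 ∧ K 3 = K 1 then mrPoint ℂ n (K 0, K 1) else 0 with hx₀'
  set x₀ : Fin m × Fin m → ℂ := Function.extend ι x₀' (fun _ => 1) with hx₀
  set I₀ : Fin 4 → Fin (n + 3) := fun _ => 0 with hI₀
  set w₀ : Fin m × Fin m → ℂ := Pi.single (ι I₀) 1 with hw₀
  have hx₀ι : ∀ u, x₀ (ι u) = x₀' u := fun u => hι.extend_apply _ _ u
  have hx₀0 : x₀ (0, 0) = 1 := by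
    rw [hx₀, Function.extend_apply' _ _ _ (fun ⟨u, hu⟩ => hι0 u hu)]
  have hw₀0 : w₀ (0, 0) = 0 := by
    rw [hw₀, Pi.single_eq_of_ne (hι0 I₀).symm]
  have hpadval : ∀ t : ℂ,
      eval (x₀ + t • w₀) (X (0, 0) ^ (m - (n + 3)) : MvPolynomial (Fin m × Fin m) ℂ) = 1 := by
    intro t
    rw [map_pow, eval_X, Pi.add_apply, Pi.smul_apply, hw₀0, smul_zero, add_zero, hx₀0, one_pow]
  -- the line, read on the array: the block embedding of the all-ones matrix with `(0,0)` entry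
  -- `-(n+2) + t`
  set Mt : ℂ → (Fin (n + 3) × Fin (n + 3) → ℂ) :=
    fun t u => if u.1 = 0 ∧ u.2 = 0 then -((n : ℂ) + 2) + t else 1 with hMt
  have hKI₀ : ∀ K : Fin 4 → Fin (n + 3), K = I₀ ↔ (K 2 = K 0 ∧ K 3 = K 1) ∧ (K 0 = 0 ∧ K 1 = 0) := by
    intro K
    constructor
    · rintro rfl
      simp [hI₀]
    · rintro ⟨⟨h2, h3⟩, h0, h1⟩
      funext j
      fin_cases j
      · exact h0
      · exact h1
      · exact h2.trans h0
      · exact h3.trans h1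
  have hline : ∀ t : ℂ, (x₀ + t • w₀) ∘ ι = fun K : Fin 4 → Fin (n + 3) =>
      if K 2 = K 0 ∧ K 3 = K 1 then Mt t (K 0, K 1) else 0 := by
    intro t
    funext K
    have hval : ((x₀ + t • w₀) ∘ ι) K = x₀' K + t * w₀ (ι K) := by
      simp only [Function.comp_apply, Pi.add_apply, Pi.smul_apply, smul_eq_mul]
      rw [hx₀ι K]
    rw [hval, hx₀', hw₀]
    dsimp only
    by_cases hK : K 2 = K 0 ∧ K 3 = K 1
    · rw [if_pos hK, if_pos hK, mrPoint_apply, hMt]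
      dsimp only
      by_cases h00 : K 0 = 0 ∧ K 1 = 0
      · have hKeq : K = I₀ := (hKI₀ K).2 ⟨hK, h00⟩
        rw [if_pos h00, if_pos h00, hKeq, Pi.single_eq_same, mul_one]
      · have hKne : ι K ≠ ι I₀ := fun h => h00 (((hKI₀ K).1 (hι h)).2)
        rw [if_neg h00, if_neg h00, Pi.single_eq_of_ne hKne, mul_zero, add_zero]
    · have hKne : ι K ≠ ι I₀ := fun h => hK (((hKI₀ K).1 (hι h)).1)
      rw [if_neg hK, if_neg hK, Pi.single_eq_of_ne hKne, mul_zero, add_zero]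
  -- values of `g` on the line: `(n+3)!·(n+2)!·t`
  have hgval : ∀ t : ℂ, eval (x₀ + t • w₀) g = t * ((n + 3).factorial * (n + 2).factorial) := by
    intro t
    rw [hg, map_mul, hpadval, one_mul, eval_rename, hline t, hHD, bfl_eval_blockArr_hyperdet (Mt t),
      hMt]
    dsimp only
    rw [eval_onesExcept_perPoly]
    ring
  -- the used block of the Hessian at `x₀`
  set S : Matrix (Fin 4 → Fin (n + 3)) (Fin 4 → Fin (n + 3)) ℂ := hess0 (transl x₀' HD) with hS
  have hHess : ∀ u v : Fin 4 → Fin (n + 3), hessianMatrix g x₀ (ι u) (ι v) = S u v := by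
    intro u v
    rw [hessianMatrix_apply, hg, pderiv_mul, hpad, zero_mul, zero_add, pderiv_mul, hpad, zero_mul,
      zero_add, map_mul, pderiv_rename hι, pderiv_rename hι, eval_rename]
    have h1 : eval x₀ (X (0, 0) ^ (m - (n + 3)) : MvPolynomial (Fin m × Fin m) ℂ) = 1 := by
      simpa using hpadval 0
    have h2 : x₀ ∘ ι = x₀' := funext hx₀ι
    rw [h1, one_mul, h2, ← hess0_transl]
  set Pat : Matrix (Fin 4 → Fin (n + 3)) (Fin 4 → Fin (n + 3)) ℂ := Matrix.of
    fun I J : Fin 4 → Fin (n + 3) =>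
      (if ((I 2 = I 0 ∧ J 2 = J 0) ∨ (I 2 = J 0 ∧ J 2 = I 0)) ∧
          ((I 3 = I 1 ∧ J 3 = J 1) ∨ (I 3 = J 1 ∧ J 3 = I 1))
        then (if I 2 = I 0 then (1 : ℂ) else -1) * (if I 3 = I 1 then 1 else -1) else 0) *
      mrHess ℂ n (I 0, I 1) (J 0, J 1) with hPat
  have hSeq : S = (((n + 3).factorial * n.factorial : ℕ) : ℂ) • Pat := by
    rw [hS, hHD, hx₀', hPat]
    exact hess0_hyperdet_blockEmb_mrPoint n
  have hSunit : IsUnit S.det := by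
    rw [← Matrix.isUnit_iff_isUnit_det]
    apply Matrix.mulVec_injective_iff_isUnit.mp
    intro v₁ v₂ hv
    rw [hSeq, Matrix.smul_mulVec, Matrix.smul_mulVec] at hv
    have hinj := stub_hdPattern_mulVec_injective n
    rw [← hPat] at hinj
    exact hinj (smul_right_injective _
      (Nat.cast_ne_zero.mpr (Nat.mul_ne_zero (Nat.factorial_ne_zero _) (Nat.factorial_ne_zero _))) hv)
  -- selection of `2m + 1` used coordinates and the matrices `U = P S⁻¹ E`, `V = P E`
  set c : Fin (2 * m + 1) → (Fin 4 → Fin (n + 3)) :=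
    fun a => finFunctionFinEquiv.symm (Fin.castLE hr a) with hc
  have hcinj : Function.Injective c := fun a b hab =>
    Fin.castLE_injective hr (finFunctionFinEquiv.symm.injective hab)
  set E : Matrix (Fin 4 → Fin (n + 3)) (Fin m × Fin m) ℂ :=
    fun b i => if i = ι b then 1 else 0 with hE
  set P : Matrix (Fin (2 * m + 1)) (Fin 4 → Fin (n + 3)) ℂ :=
    fun a b => if b = c a then 1 else 0 with hP
  have hE1 : E * hessianMatrix g x₀ * Eᵀ = S := by
    ext b b'
    simp only [Matrix.mul_apply, Matrix.transpose_apply, hE, ite_mul, one_mul, zero_mul, mul_ite,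
      mul_one, mul_zero, Finset.sum_ite_eq', Finset.mem_univ, if_true]
    exact hHess b b'
  have hE2 : P * Pᵀ = 1 := by
    ext a a'
    simp only [Matrix.mul_apply, Matrix.transpose_apply, hP, Matrix.one_apply, mul_ite, mul_one,
      mul_zero, Finset.sum_ite_eq', Finset.mem_univ, if_true]
    by_cases h : a = a'
    · simp [h]
    · rw [if_neg (fun h' => h (hcinj h').symm), if_neg h]
  have hUHV : P * S⁻¹ * E * hessianMatrix g x₀ * (P * E)ᵀ = 1 := by
    rw [Matrix.transpose_mul]
    calc P * S⁻¹ * E * hessianMatrix g x₀ * (Eᵀ * Pᵀ)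
        = P * (S⁻¹ * (E * hessianMatrix g x₀ * Eᵀ)) * Pᵀ := by simp only [Matrix.mul_assoc]
      _ = 1 := by rw [hE1, Matrix.nonsing_inv_mul _ hSunit, Matrix.mul_one, hE2]
  -- degrees of the family
  have hdeg : ∀ a, (lmrFamily m (m * ((2 * m + 1) * m)) x₀ w₀ (P * S⁻¹ * E) (P * E) g a).natDegree
      ≤ m * ((2 * m + 1) * m) + m := by
    intro a
    cases a with
    | none =>
      simp only [lmrFamily]
      refine Polynomial.natDegree_pow_le.trans ?_
      refine (Nat.mul_le_mul_left m ((natDegree_lineRestr_le _ _ _).trans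
        ((totalDegree_hessGenMinor_le _ _ _).trans (Nat.mul_le_mul_left _ hhom.totalDegree_le)))).trans ?_
      exact Nat.le_add_right _ _
    | some j =>
      simp only [lmrFamily]
      refine Polynomial.natDegree_mul_le.trans ?_
      refine (add_le_add Polynomial.natDegree_pow_le
        ((natDegree_lineRestr_le _ _ _).trans hhom.totalDegree_le)).trans ?_
      rw [Polynomial.natDegree_X, mul_one]
      have := j.2
      omega
  -- independence of the family
  have hind : ∀ κ : Option (Fin (m * ((2 * m + 1) * m) + 1)) → ℂ,
      ∑ a, κ a • lmrFamily m (m * ((2 * m + 1) * m)) x₀ w₀ (P * S⁻¹ * E) (P * E) g a = 0 → κ = 0 := by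
    intro κ hκ
    set p := lineRestr x₀ w₀ g with hp
    set q := lineRestr x₀ w₀ (hessGenMinor (P * S⁻¹ * E) (P * E) g) with hq
    have hp0 : p.eval 0 = 0 := by
      rw [hp, eval_lineRestr, hgval, zero_mul]
    have hp1 : p ≠ 0 := by
      intro h
      have := congrArg (Polynomial.eval 1) h
      rw [hp, eval_lineRestr, hgval, Polynomial.eval_zero, one_mul] at this
      exact mul_ne_zero (Nat.cast_ne_zero.mpr (Nat.factorial_ne_zero (n + 3)))
        (Nat.cast_ne_zero.mpr (Nat.factorial_ne_zero (n + 2))) this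
    have hq0 : q.eval 0 = 1 := by
      rw [hq, eval_lineRestr, eval_hessGenMinor, zero_smul, add_zero, hUHV, Matrix.det_one]
    have hnone : κ none = 0 := by
      have := congrArg (Polynomial.eval 0) hκ
      rw [Polynomial.eval_finsetSum, Fintype.sum_option, Polynomial.eval_zero] at this
      simp only [lmrFamily, Polynomial.eval_smul, Polynomial.eval_pow, Polynomial.eval_mul,
        Polynomial.eval_X, smul_eq_mul] at this
      rw [← hq, ← hp, hq0, hp0] at this
      simpa using this
    have hrest : (∑ j : Fin (m * ((2 * m + 1) * m) + 1), κ (some j) • Polynomial.X ^ (j : ℕ)) * p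
        = 0 := by
      rw [Fintype.sum_option, hnone, zero_smul, zero_add] at hκ
      rw [Finset.sum_mul]
      simpa only [lmrFamily, smul_mul_assoc, ← hp] using hκ
    have hsum : ∑ j : Fin (m * ((2 * m + 1) * m) + 1), κ (some j) • Polynomial.X ^ (j : ℕ) =
        (0 : Polynomial ℂ) :=
      (mul_eq_zero.mp hrest).resolve_right hp1
    funext a
    cases a with
    | none => exact hnone
    | some j =>
      have := congrArg (fun Q : Polynomial ℂ => Q.coeff (j : ℕ)) hsum
      simp only [Polynomial.finsetSum_coeff, Polynomial.coeff_smul, Polynomial.coeff_X_pow,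
        smul_eq_mul, mul_ite, mul_one, mul_zero, Polynomial.coeff_zero, Fin.val_inj,
        Finset.sum_ite_eq, Finset.mem_univ, if_true] at this
      exact this
  obtain ⟨L, hL⟩ := exists_lmrInvariant_eq_one x₀ w₀ (P * S⁻¹ * E) (P * E) g hdeg hind
  exact ⟨x₀, w₀, P * S⁻¹ * E, P * E, L, hL⟩

/-- **Stub C₁ — the border floor for the four-dimensional determinant**
(`\underline{dc}(H_n) ≥ n⁴/2` in placement form): for `3 ≤ n ≤ m` with `2m < n⁴` and every
injective placement `ι` of the `n⁴` array variables missing the padding variable `(0,0)`, the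
padded four-dimensional determinant `X₀₀^{m-n} H_n(X_ι)` does NOT lie in
`Δ(det_m) = \overline{GL_{m²} · det_m}`.  The Landsberg–Manivel–Ressayre invariant vanishes on
`GL · det_m` (`lmrInvariant_eq_zero_of_mem_glOrbit_detPoly`), hence on `Δ(det_m)`
(`lmrInvariant_eq_zero_of_mem_orbitClosure`), but equals `1` at the padded four-dimensional
determinant (`exists_lmrInvariant_eq_one_paddedHyperdet`).  Border upgrade of the landed affine
floor `n⁴ ≤ 2·dc(H_n)`; it is stub C of the line on the polynomial part of the window.
[cite: LandsbergManivelRessayre2013, Theorem 1.2.1] -/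
theorem stub_borderFloor (n m : ℕ) [NeZero m] (hn : 3 ≤ n) (hnm : n ≤ m) (hlt : 2 * m < n ^ 4)
    (ι : (Fin 4 → Fin n) → Fin m × Fin m) (hι : Function.Injective ι)
    (hℓ : ((0 : Fin m), (0 : Fin m)) ∉ Set.range ι) :
    X ((0 : Fin m), (0 : Fin m)) ^ (m - n) *
        rename ι (hyperdet fun I : Fin 4 → Fin n => (X I : MvPolynomial (Fin 4 → Fin n) ℂ)) ∉
      orbitClosure (detPoly (Fin m) ℂ) := by
  obtain ⟨n', rfl⟩ : ∃ n', n = n' + 3 := ⟨n - 3, by omega⟩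
  intro hmem
  have hr : 2 * m + 1 ≤ (n' + 3) ^ 4 := by omega
  obtain ⟨x, w, U, V, L, hL⟩ := exists_lmrInvariant_eq_one_paddedHyperdet ι hι hℓ hnm hr
  have hdet : (detPoly (Fin m) ℂ).IsHomogeneous m := by
    simpa using detPoly_isHomogeneous (n := Fin m) (k := ℂ)
  have h0 := lmrInvariant_eq_zero_of_mem_orbitClosure hdet hmem (m * ((2 * m + 1) * m))
    (m * ((2 * m + 1) * m) + m) x w U V L
    (fun h hh => lmrInvariant_eq_zero_of_mem_glOrbit_detPoly hh _ x w U V L)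
  rw [hL] at h0
  exact one_ne_zero h0

/-- **`\underline{dc}(H_n) ≥ n⁴/2`, numerically at `n = 3`**: the padded `H_3` is not a
degeneration of `det_m` for any `3 ≤ m ≤ 40` and any placement. [folklore] -/
theorem paddedHyperdet_three_not_mem_orbitClosure {m : ℕ} [NeZero m] (h3 : 3 ≤ m) (h40 : m ≤ 40)
    (ι : (Fin 4 → Fin 3) → Fin m × Fin m) (hι : Function.Injective ι)
    (hℓ : ((0 : Fin m), (0 : Fin m)) ∉ Set.range ι) :
    X ((0 : Fin m), (0 : Fin m)) ^ (m - 3) *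
        rename ι (hyperdet fun I : Fin 4 → Fin 3 => (X I : MvPolynomial (Fin 4 → Fin 3) ℂ)) ∉
      orbitClosure (detPoly (Fin m) ℂ) :=
  stub_borderFloor 3 m le_rfl h3 (by norm_num; omega) ι hι hℓ

end Summit.ValiantsHypothesis.ValiantsHypothesis.Theorems.DetQPDetqpThesis

end
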